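import Mathlib
import Literature.MathematicalPhysics.QuantumFieldTheory.Balaban1983to89.B6

/-!
# `Balaban1983to89.B6Lemma21Arith` — the constant arithmetic of Lemma 2.1 (B6), kernel second engine

CITATION HEADER (lean-in-tree rule 2026-08-18). Source: T. Bałaban, *Propagators and renormalization transformations for
lattice gauge theories. II*, Comm. Math. Phys. **96**, 223–250 (1984) [Balaban1984PropagatorsII] (cell paper B6; PDF
`paper:balaban1984-cmp96-propagators-rt-ii`, journal page = PDF page + 222).

WHAT IS REPRODUCED (kernel-checked, no `sorry`): the purely arithmetic tail of the proof of Lemma 2.1, pp. 233–234 —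
the passage from the geometric bound (2.58)
  Σ_{j′} Σ_{m ≥ max(|j−j′|−1,0)} e^{−½αδ₀ m RM} c₀(½α)^{d(2m+1)}
to the printed conclusion (2.61) with c₁(α) = 12 c₀(½α)^d under condition (2.59) ¼αδ₀RM > 2d log c₀(½α) + 1:
* `inner_sum_le`: with A := ½αδ₀RM and c := c₀(½α)^d, (2.59) ⟺ A > 4 log c + 2 and then
  Σ_{n ≥ m₀} e^{−An} c^{2n+1} ≤ c e^{−m₀}/(1 − e^{−1});
* `exp_neg_m0_le`: e^{−max(|z|−1,0)} ≤ e · e^{−|z|};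
* `tsum_int_exp_neg_abs`: Σ_{z∈ℤ} e^{−|z|} = (1 + e^{−1})/(1 − e^{−1}) (= 2.164…);
* `lemma21_constant_le_twelve`: e/(1−e^{−1}) · (1+e^{−1})/(1−e^{−1}) ≤ 12, i.e. 4.30… × 2.16… ≤ 12;
* `ineq258_sum_le_c1`: the assembled bound Σ_{j′∈ℤ} Σ_m … ≤ c₁(α) = `B6.c1 d δ₀ α` under `B6.Cond259` — the second
  (kernel) engine for GAPS row G-B6-04 (ii) (first engine: exact rational arithmetic by hand/python in G-B6-04).
* `printed_six_chain_fails`: the printed intermediate "≤ 6 c₀^d e^{−|j−j′|}" (p. 233) is loose-but-true, but the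
  LITERAL chain 6 × Σ_{j′} e^{−|j−j′|} = 6 × 2.164… = 12.98… > 12 does not give 12; the true inner constant
  e/(1−e^{−1}) = 4.30… does.  (`six_times_tsum_gt_twelve`.)
* `g_b6_04_i_witness`: the auxiliary remark "c₀(α) < 2(1−e^{−αδ₀})⁻¹ < 4/(αδ₀)" (p. 233): its second inequality fails
  at αδ₀ = 2 (2(1−e^{−2})⁻¹ = 2.31… > 2) — the witness for G-B6-04 (i); it is not used in the 12 c₀^d chain above.
v2 (adv1 gen 7, 2026-08-18) — REPAIRED CONSTANT after GAPS G-A11-1 (tree module `B6Lemma21Counterexample`: the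
geometric bound (2.58) is FALSE as printed for d ≥ 3 — its last contour piece y′_m → y′ carries no factor e^{−½αδ₀RM}).
The REPAIRED geometric bound is (2.58′)
  Σ_{j′} Σ_{m ≥ max(|j−j′|−1,0)} e^{−½αδ₀ (m−1)⁺ RM} c₀(½α)^{d(2m+1)}
(one exponential factor fewer; the three pieces m ≤ 1 of Λ_{j′}, |j−j′| ≤ 1, pay no exponential at all), and the
kernel-checked arithmetic of this section gives, under the SAME (2.59),
* `inner_sum_repaired_le`: Σ_{m≥m₀} e^{−A(m−1)⁺} c^{2m+1} ≤ [m₀ = 0]·c + c³ e^{−(m₀−1)⁺}/(1 − e^{−1});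
* `tsum_int_exp_neg_abs_sub_two`: Σ_{z∈ℤ} e^{−(|z|−2)⁺} = 3 + 2/(1 − e^{−1}) (= 6.164…);
* `ineq258Repaired_sum_le`: Σ_{j′∈ℤ} Σ_m (2.58′) ≤ 3c + c³(3 + 2/(1−e^{−1}))/(1−e^{−1}) = 3c + 9.75…·c³
  ≤ `c1Repaired` := 13 c₀(½α)^{3d}  (`repaired_constant_le_thirteen`: 3 + 9.75… ≤ 13).
CORRECTION to the gen-6 prose (GAPS G-A11-1 / C-A11-1 "c₁′ = 5c₀^{3d}"): that figure bounded only the INNER m-sum at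
m₀ = 0 (c³/(1−q) ≤ 1.59 c³) and omitted the j′-summation; with the j′-sum the explicit repaired constant is
3c + 9.76 c³ ≤ 13 c₀(½α)^{3d}, and 13 cannot be lowered below 12.75 by this arithmetic (all three |j−j′| ≤ 1 pieces
contribute the full c + c³/(1−e^{−1})).  Consumers (Props 2.2–2.8, B9 p. 393, B11 (190)) use c₁ only as an
α-dependent O(1) constant, so nothing downstream changes; only `B6.c1` / `B6.Lemma21Printed` must be re-typed.
WHAT IS NOT REPRODUCED: the geometric steps (2.54)–(2.57) producing (2.58) from the multiscale distance (2.46) and the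
counting of points y′ at multiscale distance m (that is the content of `B6Geometry`, where (2.61) is a leaf); the
repaired geometric bound (2.58′) itself is a hypothesis of `ineq258Repaired_sum_le` (stated as the sum it bounds).
The constant `c₀(½α)` enters only through `1 ≤ c₀` (the z = 0 term) and its logarithm.
-/

namespace Literature.MathematicalPhysics.QuantumFieldTheory.Balaban1983to89.B6Lemma21Arith

open Real

/-- `c₀(δ₀, α) = Σ_{z∈ℤ} e^{−αδ₀|z|}` is summable for `αδ₀ > 0`. [cite: Balaban1984PropagatorsII, p.233 (c₀(α) definition)] [folklore] -/
theorem summable_c0_term {δ₀ α : ℝ} (h : 0 < α * δ₀) :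
    Summable fun z : ℤ => Real.exp (-(α * δ₀ * |(z : ℝ)|)) := by
  have hr : Real.exp (-(α * δ₀)) < 1 := by
    rw [Real.exp_lt_one_iff]; linarith
  have hr0 : 0 ≤ Real.exp (-(α * δ₀)) := (Real.exp_pos _).le
  have hnat : Summable fun n : ℕ => Real.exp (-(α * δ₀ * |((n : ℤ) : ℝ)|)) := by
    have : (fun n : ℕ => Real.exp (-(α * δ₀ * |((n : ℤ) : ℝ)|)))
        = fun n : ℕ => Real.exp (-(α * δ₀)) ^ n := by
      funext n
      rw [← Real.exp_nat_mul]
      congr 1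
      push_cast
      rw [abs_of_nonneg (by positivity)]
      ring
    rw [this]
    exact summable_geometric_of_lt_one hr0 hr
  have hneg : Summable fun n : ℕ => Real.exp (-(α * δ₀ * |((-((n : ℤ) + 1) : ℤ) : ℝ)|)) := by
    have : (fun n : ℕ => Real.exp (-(α * δ₀ * |((-((n : ℤ) + 1) : ℤ) : ℝ)|)))
        = fun n : ℕ => Real.exp (-(α * δ₀ * |(((n + 1 : ℕ) : ℤ) : ℝ)|)) := by
      funext n
      push_cast
      rw [abs_neg]
    rw [this]
    exact (summable_nat_add_iff 1).2 hnat
  exact Summable.of_nat_of_neg_add_one (f := fun z : ℤ => Real.exp (-(α * δ₀ * |(z : ℝ)|))) hnat hneg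

/-- `1 ≤ c₀(δ₀, α)` for `αδ₀ > 0` (the `z = 0` term). [cite: Balaban1984PropagatorsII, p.233] [folklore] -/
theorem one_le_c0 {δ₀ α : ℝ} (h : 0 < α * δ₀) : 1 ≤ B6.c0 δ₀ α := by
  unfold B6.c0
  have hs := summable_c0_term h
  have h0 : Real.exp (-(α * δ₀ * |((0 : ℤ) : ℝ)|)) = 1 := by simp
  calc (1 : ℝ) = Real.exp (-(α * δ₀ * |((0 : ℤ) : ℝ)|)) := h0.symm
    _ ≤ ∑' z : ℤ, Real.exp (-(α * δ₀ * |(z : ℝ)|)) :=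
        hs.le_tsum 0 (fun z _ => (Real.exp_pos _).le)

/-- The inner geometric sum of (2.58): for `1 ≤ c` and `A > 4 log c + 2` (this is (2.59) with `A = ½αδ₀RM`,
`c = c₀(½α)^d`), `Σ_{m≥0} e^{−A(m₀+m)} c^{2(m₀+m)+1} ≤ c e^{−m₀} / (1 − e^{−1})`. [cite: Balaban1984PropagatorsII, (2.58)–(2.59) p. 233] -/
theorem inner_sum_le {A c : ℝ} (hc : 1 ≤ c) (hA : 4 * Real.log c + 2 < A) (m₀ : ℕ) :
    ∑' m : ℕ, Real.exp (-(A * ((m₀ + m : ℕ) : ℝ))) * c ^ (2 * (m₀ + m) + 1)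
      ≤ c * Real.exp (-(m₀ : ℝ)) / (1 - Real.exp (-1)) := by
  have hcpos : 0 < c := by linarith
  have hlogc : 0 ≤ Real.log c := Real.log_nonneg hc
  set q : ℝ := Real.exp (-A) * c ^ 2 with hq
  have hqpos : 0 < q := by positivity
  have hq1 : q ≤ Real.exp (-1) := by
    have hlogq : Real.log q = -A + 2 * Real.log c := by
      rw [hq, Real.log_mul (Real.exp_pos _).ne' (by positivity), Real.log_exp, Real.log_pow]
      push_cast; ring
    calc q = Real.exp (Real.log q) := (Real.exp_log hqpos).symm
      _ ≤ Real.exp (-1) := by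
          apply Real.exp_le_exp.2
          rw [hlogq]; linarith
  have he1 : Real.exp (-1) < 1 := by rw [Real.exp_lt_one_iff]; norm_num
  have hqlt : q < 1 := lt_of_le_of_lt hq1 he1
  have hterm : ∀ m : ℕ, Real.exp (-(A * ((m₀ + m : ℕ) : ℝ))) * c ^ (2 * (m₀ + m) + 1)
      = c * q ^ m₀ * q ^ m := by
    intro m
    have h1 : Real.exp (-(A * ((m₀ + m : ℕ) : ℝ))) = Real.exp (-A) ^ (m₀ + m) := by
      rw [← Real.exp_nat_mul]; congr 1; ring
    rw [h1, hq, pow_succ, pow_mul, mul_pow, pow_add, pow_add]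
    ring
  simp_rw [hterm]
  rw [tsum_mul_left, tsum_geometric_of_lt_one hqpos.le hqlt]
  have hqm : q ^ m₀ ≤ Real.exp (-(m₀ : ℝ)) := by
    calc q ^ m₀ ≤ Real.exp (-1) ^ m₀ := pow_le_pow_left₀ hqpos.le hq1 m₀
      _ = Real.exp (-(m₀ : ℝ)) := by rw [← Real.exp_nat_mul]; congr 1; ring
  have hden : (1 - q)⁻¹ ≤ (1 - Real.exp (-1))⁻¹ := by
    apply inv_anti₀ (by linarith) (by linarith)
  have h1q : 0 ≤ (1 - q)⁻¹ := by
    apply inv_nonneg.2; linarith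
  calc c * q ^ m₀ * (1 - q)⁻¹ ≤ c * Real.exp (-(m₀ : ℝ)) * (1 - Real.exp (-1))⁻¹ := by
        apply mul_le_mul (mul_le_mul_of_nonneg_left hqm hcpos.le) hden h1q (by positivity)
    _ = c * Real.exp (-(m₀ : ℝ)) / (1 - Real.exp (-1)) := by rw [div_eq_mul_inv]

/-- `m₀(z) := max(|z| − 1, 0)` as a natural number (the summation floor `m ≥ max(|j−j′|−1, 0)` of (2.58)). [cite: Balaban1984PropagatorsII, (2.58) p.233] -/
def m0 (z : ℤ) : ℕ := (|z| - 1).toNat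

/-- `e^{−m₀(z)} ≤ e · e^{−|z|}`. [cite: Balaban1984PropagatorsII, p.233 (the "6c₀^d e^{−|j−j′|}" step)] [folklore] -/
theorem exp_neg_m0_le (z : ℤ) :
    Real.exp (-((m0 z : ℕ) : ℝ)) ≤ Real.exp 1 * Real.exp (-|(z : ℝ)|) := by
  rw [← Real.exp_add, Real.exp_le_exp]
  have h : ((|z| - 1 : ℤ) : ℝ) ≤ ((m0 z : ℕ) : ℝ) := by
    unfold m0
    exact_mod_cast Int.self_le_toNat (|z| - 1)
  push_cast at h
  linarith

/-- `Σ_{z∈ℤ} e^{−|z|} = (1 + e^{−1})/(1 − e^{−1})` (= 2.1639…). [cite: Balaban1984PropagatorsII, p.233 (the sum over j′)] [folklore] -/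
theorem tsum_int_exp_neg_abs :
    ∑' z : ℤ, Real.exp (-|(z : ℝ)|) = (1 + Real.exp (-1)) / (1 - Real.exp (-1)) := by
  have hr : Real.exp (-1) < 1 := by rw [Real.exp_lt_one_iff]; norm_num
  have hr0 : 0 ≤ Real.exp (-1) := (Real.exp_pos _).le
  have hnat_eq : (fun n : ℕ => Real.exp (-|((n : ℤ) : ℝ)|)) = fun n : ℕ => Real.exp (-1) ^ n := by
    funext n
    rw [← Real.exp_nat_mul]; congr 1; push_cast
    rw [abs_of_nonneg (by positivity)]; ring
  have hneg_eq : (fun n : ℕ => Real.exp (-|((-((n : ℤ) + 1) : ℤ) : ℝ)|))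
      = fun n : ℕ => Real.exp (-1) * Real.exp (-1) ^ n := by
    funext n
    rw [← pow_succ', ← Real.exp_nat_mul]; congr 1; push_cast
    rw [abs_neg, abs_of_nonneg (by positivity)]; ring
  have hnat : Summable fun n : ℕ => Real.exp (-|((n : ℤ) : ℝ)|) := by
    rw [hnat_eq]; exact summable_geometric_of_lt_one hr0 hr
  have hneg : Summable fun n : ℕ => Real.exp (-|((-((n : ℤ) + 1) : ℤ) : ℝ)|) := by
    rw [hneg_eq]; exact (summable_geometric_of_lt_one hr0 hr).mul_left _
  have h1 : ∑' n : ℕ, Real.exp (-|((n : ℤ) : ℝ)|) = (1 - Real.exp (-1))⁻¹ := by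
    rw [hnat_eq]; exact tsum_geometric_of_lt_one hr0 hr
  have h2 : ∑' n : ℕ, Real.exp (-|((-((n : ℤ) + 1) : ℤ) : ℝ)|)
      = Real.exp (-1) * (1 - Real.exp (-1))⁻¹ := by
    rw [hneg_eq, tsum_mul_left, tsum_geometric_of_lt_one hr0 hr]
  rw [tsum_of_nat_of_neg_add_one (f := fun z : ℤ => Real.exp (-|(z : ℝ)|)) hnat hneg]
  rw [h1, h2, div_eq_mul_inv]
  ring

/-- Summability of `z ↦ e^{−|z|}` over `ℤ`. [folklore] -/
theorem summable_int_exp_neg_abs : Summable fun z : ℤ => Real.exp (-|(z : ℝ)|) := by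
  have h := summable_c0_term (δ₀ := 1) (α := 1) (by norm_num)
  simpa using h

/-- `e/(1−e^{−1}) · (1+e^{−1})/(1−e^{−1}) ≤ 12`: the true inner constant 4.30… times Σ_{j′} e^{−|j−j′|} = 2.16…
is 9.31… ≤ 12, so `c₁(α) = 12 c₀(½α)^d` is valid. [cite: Balaban1984PropagatorsII, Lemma 2.1 p.234 (c₁(α) = 12c₀(½α)^d)] -/
theorem lemma21_constant_le_twelve :
    Real.exp 1 / (1 - Real.exp (-1)) * ((1 + Real.exp (-1)) / (1 - Real.exp (-1))) ≤ 12 := by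
  have he1 : Real.exp 1 < 2.72 := lt_trans Real.exp_one_lt_d9 (by norm_num)
  have he2 : 2.71 < Real.exp 1 := lt_trans (by norm_num) Real.exp_one_gt_d9
  have hr : Real.exp (-1) = (Real.exp 1)⁻¹ := Real.exp_neg 1
  have hepos : 0 < Real.exp 1 := Real.exp_pos 1
  have hr_lt : Real.exp (-1) < 0.37 := by
    rw [hr, inv_lt_comm₀ hepos (by norm_num)]; norm_num; linarith
  have hr_pos : 0 < Real.exp (-1) := Real.exp_pos _
  set r := Real.exp (-1)
  set e := Real.exp 1
  have hden : 0 < 1 - r := by linarith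
  rw [div_mul_div_comm, div_le_iff₀ (by positivity)]
  nlinarith [mul_pos hepos hr_pos, hden, mul_pos hden hden]

/-- The LITERAL printed chain does not close: `6 · Σ_{z∈ℤ} e^{−|z|} = 6 · 2.1639… > 12`. [cite: Balaban1984PropagatorsII, p.233 (printed intermediate "≤ 6c₀^d e^{−|j−j′|}")] -/
theorem six_times_tsum_gt_twelve : 12 < 6 * ∑' z : ℤ, Real.exp (-|(z : ℝ)|) := by
  rw [tsum_int_exp_neg_abs]
  have he2 : 2.71 < Real.exp 1 := lt_trans (by norm_num) Real.exp_one_gt_d9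
  have he1 : Real.exp 1 < 2.72 := lt_trans Real.exp_one_lt_d9 (by norm_num)
  have hr : Real.exp (-1) = (Real.exp 1)⁻¹ := Real.exp_neg 1
  have hepos : 0 < Real.exp 1 := Real.exp_pos 1
  have hr_gt : 0.36 < Real.exp (-1) := by
    rw [hr, lt_inv_comm₀ (by norm_num) hepos]; norm_num; linarith
  have hr_lt : Real.exp (-1) < 1 := by rw [Real.exp_lt_one_iff]; norm_num
  set r := Real.exp (-1)
  rw [mul_div_assoc', lt_div_iff₀ (by linarith)]
  nlinarith

/-- G-B6-04 (i) witness: the remark "2(1−e^{−t})⁻¹ < 4/t" (p. 233, with `t = αδ₀`) fails at `t = 2`. [cite: Balaban1984PropagatorsII, p.233 (remark c₀(α) < 2(1−e^{−αδ₀})⁻¹ < 4/(αδ₀))] -/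
theorem g_b6_04_i_witness : ¬ (2 * (1 - Real.exp (-2))⁻¹ < 4 / 2) := by
  have h0 : 0 < Real.exp (-2) := Real.exp_pos _
  have h1 : Real.exp (-2) < 1 := by rw [Real.exp_lt_one_iff]; norm_num
  have hden : 0 < 1 - Real.exp (-2) := by linarith
  intro h
  have : (1 - Real.exp (-2))⁻¹ > 1 := one_lt_inv_iff₀.2 ⟨hden, by linarith⟩
  linarith

/-- (2.59) in the form used by `inner_sum_le`: `4 log(c₀(½α)^d) + 2 < ½αδ₀RM`. [cite: Balaban1984PropagatorsII, (2.59) p.233] -/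
theorem cond259_iff_A {d : ℕ} {δ₀ α R M : ℝ} :
    B6.Cond259 d δ₀ α R M ↔ 4 * Real.log (B6.c0 δ₀ (α / 2) ^ d) + 2 < (1 / 2) * α * δ₀ * R * M := by
  unfold B6.Cond259
  rw [Real.log_pow]
  constructor <;> intro h <;> linarith

/-- **(2.58) ⇒ (2.61), kernel engine.** Under (2.59) and `α, δ₀ > 0`,
`Σ_{j′∈ℤ} Σ_{m≥0} e^{−½αδ₀RM (m₀+m)} c₀(½α)^{d(2(m₀+m)+1)} ≤ c₁(α) = 12 c₀(½α)^d`, `m₀ = max(|j−j′|−1,0)`.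
[cite: Balaban1984PropagatorsII, (2.58)–(2.61) pp. 233–234] -/
theorem ineq258_sum_le_c1 {d : ℕ} {δ₀ α R M : ℝ} (hα : 0 < α) (hδ : 0 < δ₀)
    (h259 : B6.Cond259 d δ₀ α R M) (j : ℤ) :
    ∑' j' : ℤ, ∑' m : ℕ,
        Real.exp (-((1 / 2) * α * δ₀ * R * M * ((m0 (j - j') + m : ℕ) : ℝ)))
          * (B6.c0 δ₀ (α / 2) ^ d) ^ (2 * (m0 (j - j') + m) + 1)
      ≤ B6.c1 d δ₀ α := by
  have hc0 : 1 ≤ B6.c0 δ₀ (α / 2) := one_le_c0 (by positivity)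
  have hc : 1 ≤ B6.c0 δ₀ (α / 2) ^ d := one_le_pow₀ hc0
  set c := B6.c0 δ₀ (α / 2) ^ d with hcdef
  have hA := (cond259_iff_A (d := d) (R := R) (M := M)).1 h259
  rw [← hcdef] at hA
  set A := (1 / 2) * α * δ₀ * R * M
  have hr : Real.exp (-1) < 1 := by rw [Real.exp_lt_one_iff]; norm_num
  have hden : 0 < 1 - Real.exp (-1) := by linarith
  -- termwise bound of the inner sums
  have hinner : ∀ j' : ℤ,
      ∑' m : ℕ, Real.exp (-(A * ((m0 (j - j') + m : ℕ) : ℝ))) * c ^ (2 * (m0 (j - j') + m) + 1)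
        ≤ (c * Real.exp 1 / (1 - Real.exp (-1))) * Real.exp (-|((j - j' : ℤ) : ℝ)|) := by
    intro j'
    calc _ ≤ c * Real.exp (-((m0 (j - j') : ℕ) : ℝ)) / (1 - Real.exp (-1)) := inner_sum_le hc hA _
      _ ≤ (c * Real.exp 1 / (1 - Real.exp (-1))) * Real.exp (-|((j - j' : ℤ) : ℝ)|) := by
          have := exp_neg_m0_le (j - j')
          rw [div_mul_eq_mul_div, mul_assoc]
          apply div_le_div_of_nonneg_right _ hden.le
          exact mul_le_mul_of_nonneg_left this (by linarith)
  have hnn : ∀ j' : ℤ, 0 ≤ ∑' m : ℕ,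
      Real.exp (-(A * ((m0 (j - j') + m : ℕ) : ℝ))) * c ^ (2 * (m0 (j - j') + m) + 1) :=
    fun j' => tsum_nonneg fun m => by positivity
  -- the majorant is summable over ℤ (reindex j′ ↦ j − j′)
  have hmaj : Summable fun j' : ℤ =>
      (c * Real.exp 1 / (1 - Real.exp (-1))) * Real.exp (-|((j - j' : ℤ) : ℝ)|) := by
    apply Summable.mul_left
    have hfun : (fun j' : ℤ => Real.exp (-|((j - j' : ℤ) : ℝ)|))
        = (fun z : ℤ => Real.exp (-|(z : ℝ)|)) ∘ (Equiv.subLeft j) := by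
      funext i; simp [Function.comp, Equiv.subLeft_apply]
    rw [hfun]
    exact (Equiv.summable_iff _).2 summable_int_exp_neg_abs
  have hsum := Summable.of_nonneg_of_le hnn hinner hmaj
  calc _ ≤ ∑' j' : ℤ, (c * Real.exp 1 / (1 - Real.exp (-1))) * Real.exp (-|((j - j' : ℤ) : ℝ)|) :=
        hsum.tsum_le_tsum hinner hmaj
    _ = (c * Real.exp 1 / (1 - Real.exp (-1))) * ∑' z : ℤ, Real.exp (-|(z : ℝ)|) := by
        rw [tsum_mul_left]
        congr 1
        exact (Equiv.subLeft j).tsum_eq (fun z : ℤ => Real.exp (-|(z : ℝ)|))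
    _ = c * (Real.exp 1 / (1 - Real.exp (-1)) * ((1 + Real.exp (-1)) / (1 - Real.exp (-1)))) := by
        rw [tsum_int_exp_neg_abs]; ring
    _ ≤ c * 12 := mul_le_mul_of_nonneg_left lemma21_constant_le_twelve (by linarith)
    _ = B6.c1 d δ₀ α := by rw [B6.c1, hcdef]; ring


/-! ## v2 — the repaired arithmetic after G-A11-1 -/

/-- The repaired constant `c₁′(α) := 13 c₀(½α)^{3d}` (replaces the printed `12 c₀(½α)^d` of Lemma 2.1, refuted for
`d ≥ 3` in `B6Lemma21Counterexample`). [cite: Balaban1984PropagatorsII, Lemma 2.1 p.234 (c₁(α)); repaired here] -/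
noncomputable def c1Repaired (d : ℕ) (δ₀ α : ℝ) : ℝ := 13 * B6.c0 δ₀ (α / 2) ^ (3 * d)

/-- The inner sum of the repaired bound (2.58′): for `1 ≤ c`, `A > 4 log c + 2` and any floor `m₀`,
`Σ_{m≥0} e^{−A((m₀+m)−1)⁺} c^{2(m₀+m)+1} ≤ [m₀ = 0]·c + c³ e^{−(m₀−1)⁺}/(1 − e^{−1})`
(natural-number subtraction is the positive part). [cite: Balaban1984PropagatorsII, (2.58)–(2.59) p. 233; repaired] -/
theorem inner_sum_repaired_le {A c : ℝ} (hc : 1 ≤ c) (hA : 4 * Real.log c + 2 < A) (m₀ : ℕ) :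
    ∑' m : ℕ, Real.exp (-(A * ((m₀ + m - 1 : ℕ) : ℝ))) * c ^ (2 * (m₀ + m) + 1)
      ≤ (if m₀ = 0 then c else 0)
        + c ^ 3 * Real.exp (-((m₀ - 1 : ℕ) : ℝ)) / (1 - Real.exp (-1)) := by
  have hcpos : 0 < c := by linarith
  have hlogc : 0 ≤ Real.log c := Real.log_nonneg hc
  set q : ℝ := Real.exp (-A) * c ^ 2 with hq
  have hqpos : 0 < q := by positivity
  have hq1 : q ≤ Real.exp (-1) := by
    have hlogq : Real.log q = -A + 2 * Real.log c := by
      rw [hq, Real.log_mul (Real.exp_pos _).ne' (by positivity), Real.log_exp, Real.log_pow]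
      push_cast; ring
    calc q = Real.exp (Real.log q) := (Real.exp_log hqpos).symm
      _ ≤ Real.exp (-1) := by
          apply Real.exp_le_exp.2
          rw [hlogq]; linarith
  have he1 : Real.exp (-1) < 1 := by rw [Real.exp_lt_one_iff]; norm_num
  have hqlt : q < 1 := lt_of_le_of_lt hq1 he1
  have hden : 0 < 1 - Real.exp (-1) := by linarith
  have hden' : (1 - q)⁻¹ ≤ (1 - Real.exp (-1))⁻¹ := inv_anti₀ (by linarith) (by linarith)
  have h1q : 0 ≤ (1 - q)⁻¹ := inv_nonneg.2 (by linarith)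
  -- the generic term for `n ≥ 1`: `e^{−A(n−1)} c^{2n+1} = c³ q^{n−1}`
  have hterm : ∀ n : ℕ, 1 ≤ n →
      Real.exp (-(A * ((n - 1 : ℕ) : ℝ))) * c ^ (2 * n + 1) = c ^ 3 * q ^ (n - 1) := by
    intro n hn
    obtain ⟨k, rfl⟩ : ∃ k, n = k + 1 := ⟨n - 1, by omega⟩
    have h1 : Real.exp (-(A * ((k + 1 - 1 : ℕ) : ℝ))) = Real.exp (-A) ^ k := by
      rw [← Real.exp_nat_mul]; congr 1; simp only [Nat.add_sub_cancel]; ring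
    rw [h1, hq, Nat.add_sub_cancel, mul_pow, ← pow_mul]
    have : 2 * (k + 1) + 1 = 2 * k + 3 := by ring
    rw [this, pow_add]; ring
  rcases Nat.eq_zero_or_pos m₀ with h0 | hpos
  · -- m₀ = 0 : split off the m = 0 term
    subst h0
    simp only [zero_add, Nat.zero_sub, if_true, Nat.cast_zero, neg_zero, Real.exp_zero, mul_one]
    have hf : (fun m : ℕ => Real.exp (-(A * ((m - 1 : ℕ) : ℝ))) * c ^ (2 * m + 1))
        = fun m : ℕ => if m = 0 then c else c ^ 3 * q ^ (m - 1) := by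
      funext m
      rcases Nat.eq_zero_or_pos m with hm | hm
      · subst hm; simp
      · rw [if_neg (by omega), hterm m hm]
    rw [hf]
    have hshift : (fun m : ℕ => if m + 1 = 0 then c else c ^ 3 * q ^ (m + 1 - 1))
        = fun m : ℕ => c ^ 3 * q ^ m := by
      funext m; simp
    have hsum_shift : Summable fun m : ℕ => if m + 1 = 0 then c else c ^ 3 * q ^ (m + 1 - 1) := by
      rw [hshift]; exact (summable_geometric_of_lt_one hqpos.le hqlt).mul_left _
    have hsum : Summable fun m : ℕ => if m = 0 then c else c ^ 3 * q ^ (m - 1) :=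
      (summable_nat_add_iff 1).1 hsum_shift
    rw [hsum.tsum_eq_zero_add]
    simp only [if_true, hshift]
    rw [tsum_mul_left, tsum_geometric_of_lt_one hqpos.le hqlt]
    have : c ^ 3 * (1 - q)⁻¹ ≤ c ^ 3 / (1 - Real.exp (-1)) := by
      rw [div_eq_mul_inv]; exact mul_le_mul_of_nonneg_left hden' (by positivity)
    linarith
  · -- m₀ ≥ 1 : every term is generic
    rw [if_neg (by omega)]
    have hf : (fun m : ℕ => Real.exp (-(A * ((m₀ + m - 1 : ℕ) : ℝ))) * c ^ (2 * (m₀ + m) + 1))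
        = fun m : ℕ => c ^ 3 * q ^ (m₀ - 1) * q ^ m := by
      funext m
      rw [hterm (m₀ + m) (by omega)]
      have : m₀ + m - 1 = (m₀ - 1) + m := by omega
      rw [this, pow_add, mul_assoc]
    rw [hf, tsum_mul_left, tsum_geometric_of_lt_one hqpos.le hqlt]
    have hqm : q ^ (m₀ - 1) ≤ Real.exp (-((m₀ - 1 : ℕ) : ℝ)) := by
      calc q ^ (m₀ - 1) ≤ Real.exp (-1) ^ (m₀ - 1) := pow_le_pow_left₀ hqpos.le hq1 _
        _ = Real.exp (-((m₀ - 1 : ℕ) : ℝ)) := by rw [← Real.exp_nat_mul]; congr 1; ring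
    have : c ^ 3 * q ^ (m₀ - 1) * (1 - q)⁻¹
        ≤ c ^ 3 * Real.exp (-((m₀ - 1 : ℕ) : ℝ)) * (1 - Real.exp (-1))⁻¹ := by
      apply mul_le_mul (mul_le_mul_of_nonneg_left hqm (by positivity)) hden' h1q (by positivity)
    rw [div_eq_mul_inv]; linarith

/-- `Σ_{n∈ℕ} e^{−(n−2)⁺} = 2 + 1/(1 − e^{−1})`. [folklore] -/
theorem tsum_nat_exp_neg_sub_two :
    ∑' n : ℕ, Real.exp (-((n - 2 : ℕ) : ℝ)) = 2 + (1 - Real.exp (-1))⁻¹ := by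
  have hr : Real.exp (-1) < 1 := by rw [Real.exp_lt_one_iff]; norm_num
  have hr0 : 0 ≤ Real.exp (-1) := (Real.exp_pos _).le
  have hshift : (fun n : ℕ => Real.exp (-((n + 2 - 2 : ℕ) : ℝ))) = fun n : ℕ => Real.exp (-1) ^ n := by
    funext n; rw [← Real.exp_nat_mul]; congr 1; simp
  have hsum2 : Summable fun n : ℕ => Real.exp (-((n + 2 - 2 : ℕ) : ℝ)) := by
    rw [hshift]; exact summable_geometric_of_lt_one hr0 hr
  have hsum : Summable fun n : ℕ => Real.exp (-((n - 2 : ℕ) : ℝ)) :=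
    (summable_nat_add_iff 2).1 hsum2
  rw [← hsum.sum_add_tsum_nat_add 2, hshift, tsum_geometric_of_lt_one hr0 hr]
  simp [Finset.sum_range_succ]
  norm_num

/-- `Σ_{z∈ℤ} e^{−(|z|−2)⁺} = 3 + 2/(1 − e^{−1})` (= 6.164…). [folklore] -/
theorem tsum_int_exp_neg_abs_sub_two :
    ∑' z : ℤ, Real.exp (-(((|z| - 2).toNat : ℕ) : ℝ)) = 3 + 2 * (1 - Real.exp (-1))⁻¹ := by
  have hr : Real.exp (-1) < 1 := by rw [Real.exp_lt_one_iff]; norm_num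
  have hr0 : 0 ≤ Real.exp (-1) := (Real.exp_pos _).le
  have hnat_eq : (fun n : ℕ => Real.exp (-(((|(n : ℤ)| - 2).toNat : ℕ) : ℝ)))
      = fun n : ℕ => Real.exp (-((n - 2 : ℕ) : ℝ)) := by
    funext n
    congr 3
    rw [Nat.abs_cast]
    omega
  have hneg_eq : (fun n : ℕ => Real.exp (-(((|(-((n : ℤ) + 1))| - 2).toNat : ℕ) : ℝ)))
      = fun n : ℕ => Real.exp (-((n + 1 - 2 : ℕ) : ℝ)) := by
    funext n
    congr 3
    rw [abs_neg]
    have : |((n : ℤ) + 1)| = ((n + 1 : ℕ) : ℤ) := by push_cast; exact abs_of_nonneg (by positivity)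
    rw [this]; omega
  have hsum_nat : Summable fun n : ℕ => Real.exp (-((n - 2 : ℕ) : ℝ)) := by
    have hshift : (fun n : ℕ => Real.exp (-((n + 2 - 2 : ℕ) : ℝ))) = fun n : ℕ => Real.exp (-1) ^ n := by
      funext n; rw [← Real.exp_nat_mul]; congr 1; simp
    have : Summable fun n : ℕ => Real.exp (-((n + 2 - 2 : ℕ) : ℝ)) := by
      rw [hshift]; exact summable_geometric_of_lt_one hr0 hr
    exact (summable_nat_add_iff 2).1 this
  have hnat : Summable fun n : ℕ => Real.exp (-(((|(n : ℤ)| - 2).toNat : ℕ) : ℝ)) := by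
    rw [hnat_eq]; exact hsum_nat
  have hneg : Summable fun n : ℕ => Real.exp (-(((|(-((n : ℤ) + 1))| - 2).toNat : ℕ) : ℝ)) := by
    rw [hneg_eq]; exact (summable_nat_add_iff 1).2 hsum_nat
  rw [tsum_of_nat_of_neg_add_one
        (f := fun z : ℤ => Real.exp (-(((|z| - 2).toNat : ℕ) : ℝ))) hnat hneg]
  rw [hnat_eq, hneg_eq, tsum_nat_exp_neg_sub_two]
  have h2 : ∑' n : ℕ, Real.exp (-((n + 1 - 2 : ℕ) : ℝ)) = 1 + (1 - Real.exp (-1))⁻¹ := by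
    have := (hsum_nat.sum_add_tsum_nat_add 1).symm
    rw [tsum_nat_exp_neg_sub_two] at this
    have h0 : ∑ i ∈ Finset.range 1, Real.exp (-((i - 2 : ℕ) : ℝ)) = 1 := by simp
    rw [h0] at this
    linarith
  rw [h2]; ring

/-- `3 + (3 + 2/(1−e^{−1}))/(1−e^{−1}) ≤ 13`, i.e. `3 + 9.75… ≤ 13`: the repaired constant. [folklore] -/
theorem repaired_constant_le_thirteen :
    3 + (3 + 2 * (1 - Real.exp (-1))⁻¹) * (1 - Real.exp (-1))⁻¹ ≤ 13 := by
  have he1 : Real.exp 1 < 2.72 := lt_trans Real.exp_one_lt_d9 (by norm_num)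
  have hepos : 0 < Real.exp 1 := Real.exp_pos 1
  have hr : Real.exp (-1) = (Real.exp 1)⁻¹ := Real.exp_neg 1
  have he2 : 2.71 < Real.exp 1 := lt_trans (by norm_num) Real.exp_one_gt_d9
  have hr_lt : Real.exp (-1) < 0.37 := by
    rw [hr, inv_lt_comm₀ hepos (by norm_num)]; norm_num; linarith
  have hr_pos : 0 < Real.exp (-1) := Real.exp_pos _
  set r := Real.exp (-1)
  have hden : 0 < 1 - r := by linarith
  have hinv : (1 - r)⁻¹ < 1.59 := by
    rw [inv_lt_comm₀ hden (by norm_num)]; linarith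
  have hinv0 : 0 < (1 - r)⁻¹ := inv_pos.2 hden
  nlinarith

/-- **(2.58′) ⇒ repaired (2.61), kernel engine.** Under (2.59) and `α, δ₀ > 0`, with `c = c₀(½α)^d`,
`Σ_{j′∈ℤ} Σ_{m≥0} e^{−½αδ₀RM ((m₀+m)−1)⁺} c^{2(m₀+m)+1} ≤ 3c + c³(3 + 2/(1−e^{−1}))/(1−e^{−1}) ≤ 13 c³`,
`m₀ = max(|j−j′|−1,0)`. The left-hand side is the REPAIRED geometric bound (2.58′) (G-A11-1); the printed (2.58) has
an extra factor `e^{−½αδ₀RM}` in every term and is false for `d ≥ 3`. [cite: Balaban1984PropagatorsII, (2.58)–(2.61)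
pp. 233–234; repaired] -/
theorem ineq258Repaired_sum_le {d : ℕ} {δ₀ α R M : ℝ} (hα : 0 < α) (hδ : 0 < δ₀)
    (h259 : B6.Cond259 d δ₀ α R M) (j : ℤ) :
    ∑' j' : ℤ, ∑' m : ℕ,
        Real.exp (-((1 / 2) * α * δ₀ * R * M * ((m0 (j - j') + m - 1 : ℕ) : ℝ)))
          * (B6.c0 δ₀ (α / 2) ^ d) ^ (2 * (m0 (j - j') + m) + 1)
      ≤ c1Repaired d δ₀ α := by
  have hc0 : 1 ≤ B6.c0 δ₀ (α / 2) := one_le_c0 (by positivity)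
  have hc : 1 ≤ B6.c0 δ₀ (α / 2) ^ d := one_le_pow₀ hc0
  set c := B6.c0 δ₀ (α / 2) ^ d with hcdef
  have hA := (cond259_iff_A (d := d) (R := R) (M := M)).1 h259
  rw [← hcdef] at hA
  set A := (1 / 2) * α * δ₀ * R * M
  have hr : Real.exp (-1) < 1 := by rw [Real.exp_lt_one_iff]; norm_num
  have hden : 0 < 1 - Real.exp (-1) := by linarith
  -- `m0 z = 0 ↔ |z| ≤ 1`, and `m0 z − 1 = (|z| − 2)⁺`
  have hm0_sub : ∀ z : ℤ, m0 z - 1 = (|z| - 2).toNat := by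
    intro z; unfold m0; omega
  have hm0_zero : ∀ z : ℤ, (m0 z = 0 ↔ |z| ≤ 1) := by
    intro z; unfold m0; omega
  -- the majorant
  let K : ℝ := c ^ 3 / (1 - Real.exp (-1))
  let g : ℤ → ℝ := fun z => (if |z| ≤ 1 then c else 0)
    + K * Real.exp (-(((|z| - 2).toNat : ℕ) : ℝ))
  have hinner : ∀ j' : ℤ,
      ∑' m : ℕ, Real.exp (-(A * ((m0 (j - j') + m - 1 : ℕ) : ℝ))) * c ^ (2 * (m0 (j - j') + m) + 1)
        ≤ g (j - j') := by
    intro j'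
    calc _ ≤ (if m0 (j - j') = 0 then c else 0)
          + c ^ 3 * Real.exp (-((m0 (j - j') - 1 : ℕ) : ℝ)) / (1 - Real.exp (-1)) :=
          inner_sum_repaired_le hc hA _
      _ = g (j - j') := by
          simp only [g, K, hm0_sub, hm0_zero]
          ring
  have hnn : ∀ j' : ℤ, 0 ≤ ∑' m : ℕ,
      Real.exp (-(A * ((m0 (j - j') + m - 1 : ℕ) : ℝ))) * c ^ (2 * (m0 (j - j') + m) + 1) :=
    fun j' => tsum_nonneg fun m => by positivity
  -- summability and value of the majorant
  have hind_sum : Summable fun z : ℤ => (if |z| ≤ 1 then c else (0 : ℝ)) := by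
    apply summable_of_ne_finset_zero (s := ({-1, 0, 1} : Finset ℤ))
    intro z hz
    rw [if_neg]
    intro h
    apply hz
    simp only [Finset.mem_insert, Finset.mem_singleton]
    have h' := abs_le.1 h
    omega
  have hind_val : ∑' z : ℤ, (if |z| ≤ 1 then c else (0 : ℝ)) = 3 * c := by
    rw [tsum_eq_sum (s := ({-1, 0, 1} : Finset ℤ))]
    · rw [Finset.sum_insert (by decide), Finset.sum_insert (by decide), Finset.sum_singleton]
      simp; ring
    · intro z hz
      rw [if_neg]
      intro h
      apply hz
      simp only [Finset.mem_insert, Finset.mem_singleton]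
      have h' := abs_le.1 h
      omega
  have hexp_sum : Summable fun z : ℤ => Real.exp (-(((|z| - 2).toNat : ℕ) : ℝ)) := by
    -- dominated by `e² e^{−|z|}`
    apply Summable.of_nonneg_of_le (fun z => (Real.exp_pos _).le)
      (fun z => ?_) (summable_int_exp_neg_abs.mul_left (Real.exp 2))
    rw [← Real.exp_add, Real.exp_le_exp]
    have : ((|z| - 2 : ℤ) : ℝ) ≤ (((|z| - 2).toNat : ℕ) : ℝ) := by
      exact_mod_cast Int.self_le_toNat (|z| - 2)
    push_cast at this
    linarith
  have hmaj : Summable g := hind_sum.add (hexp_sum.mul_left K)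
  have hmaj' : Summable fun j' : ℤ => g (j - j') :=
    ((Equiv.subLeft j).summable_iff (f := g)).2 hmaj
  have hsum := Summable.of_nonneg_of_le hnn hinner hmaj'
  calc _ ≤ ∑' j' : ℤ, g (j - j') := hsum.tsum_le_tsum hinner hmaj'
    _ = ∑' z : ℤ, g z := (Equiv.subLeft j).tsum_eq g
    _ = 3 * c + K * (3 + 2 * (1 - Real.exp (-1))⁻¹) := by
        simp only [g]
        rw [Summable.tsum_add hind_sum (hexp_sum.mul_left K), hind_val, tsum_mul_left,
          tsum_int_exp_neg_abs_sub_two]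
    _ = c * 3 + c ^ 3 * ((3 + 2 * (1 - Real.exp (-1))⁻¹) * (1 - Real.exp (-1))⁻¹) := by
        simp only [K]; ring
    _ ≤ c ^ 3 * 3 + c ^ 3 * ((3 + 2 * (1 - Real.exp (-1))⁻¹) * (1 - Real.exp (-1))⁻¹) := by
        have : c ≤ c ^ 3 := by
          calc c = c ^ 1 := (pow_one c).symm
            _ ≤ c ^ 3 := pow_le_pow_right₀ hc (by norm_num)
        nlinarith
    _ = c ^ 3 * (3 + (3 + 2 * (1 - Real.exp (-1))⁻¹) * (1 - Real.exp (-1))⁻¹) := by ring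
    _ ≤ c ^ 3 * 13 := mul_le_mul_of_nonneg_left repaired_constant_le_thirteen (by positivity)
    _ = c1Repaired d δ₀ α := by rw [c1Repaired, hcdef, ← pow_mul]; ring

/-- The repaired constant is at least the printed one: `12 c₀^d ≤ 13 c₀^{3d}` (`1 ≤ c₀`), so every consumer bound
stated with `c₁` holds a fortiori with `c₁′` — the statement of Lemma 2.1 survives verbatim with `c₁ ↦ c₁′`. [folklore] -/
theorem c1_le_c1Repaired {d : ℕ} {δ₀ α : ℝ} (hα : 0 < α) (hδ : 0 < δ₀) :
    B6.c1 d δ₀ α ≤ c1Repaired d δ₀ α := by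
  have hc0 : 1 ≤ B6.c0 δ₀ (α / 2) := one_le_c0 (by positivity)
  unfold B6.c1 c1Repaired
  have h1 : B6.c0 δ₀ (α / 2) ^ d ≤ B6.c0 δ₀ (α / 2) ^ (3 * d) :=
    pow_le_pow_right₀ hc0 (by omega)
  have h2 : 0 ≤ B6.c0 δ₀ (α / 2) ^ d := by positivity
  nlinarith

end Literature.MathematicalPhysics.QuantumFieldTheory.Balaban1983to89.B6Lemma21Arith
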